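import Summits.PneNP.PneNP.Theses.OneSlice
import Literature.Computability.Complexity.CircuitLowerBoundsProofs
import Literature.Computability.Complexity.Rossman2008CliqueProofs
import Literature.Computability.Complexity.RossmanMonotoneCliqueGraphs
import Literature.Computability.Complexity.CliqueThresholdBounds

/-!
# Disproof of `ConstantBand` — findings (standing disprover, gen 1, cycles 1–2)

Crux `stmt-PneNP-2834` = `Summit.PneNP.PneNP.Theses.OneSlice.ConstantBand` (route PneNP/OneSlice, rung #3):
`∀ c, ∃ k ≥ 3, ∃ w, ∃ δ > 0, ∀ᶠ n, ∀ j` central (`|j - m_k(n)| ≤ m_k(n)^{3/4}`,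
`m_k(n) = ⌊C(n,2)·n^{-2/(k-1)}⌋₊`), `∀ C` over `{∧₂, ∨₂}`:
`Σ_{i ∈ [j-w, j+w]} #{x : e(x) = i, C(x) ≠ CLIQUE_k(x)} / #{x : e(x) = i} ≤ δ ⟹ n^c < |C|`.

VERDICT SO FAR: **not refuted, not mis-stated**. LANDED (importable, namespace
`Summit.PneNP.PneNP.Theorems.ConstantBand.Negative`): `Theorems/ConstantBand/Negative/LoadBearing.lean` (p74931, §0–§2)
and `Theorems/ConstantBand/Negative/ExponentVsK.lean` (p90599, §3); `Theorems/ConstantBand/Negative/DeltaFloor.lean` (p90773,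
§4 + §4b). The §4 slice-counting toolkit was also adopted by the line lead as `ts_*` in
`Theorems/OneSliceConstantBandTransferStepAux.lean` (landed) — import that rather than copying from here. The statement elaborates (rc 0), its inline clique
function IS `cliqueFn` and its inline edge count IS `edgeCount` (`constantBand_iff`, by `Iff.rfl`), its
junk operators are harmless (real division by an empty slice only for `i > C(n,2)`, ℕ-subtraction `j - w`
only shortens the band), and its hypothesis class is inhabited (`exists_exact_monotone_cliqueFn`: the
monotone DNF is exact on every slice), so it is neither vacuous nor trivially true.

Findings (all `sorry`-free):
* §0 `constantBand_iff`, `not_constantBand_iff` — schedule form `BandLB c k w δ`; WHAT A KILL MUST DELIVER: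
  one exponent `c` and, for EVERY `k ≥ 3`, every width `w` and every `δ > 0`, infinitely many `n` with a
  monotone circuit of size `≤ n^c` whose band error at some central `j` is `≤ δ`.
* §0 monotonicity: `BandLB` is monotone in `w` (`BandLB.mono_width`: wider band = weaker claim), antitone in
  `δ` and in `c`; so `∃ w` may be read "for all large `w`" (`constantBand_iff_eventually_width`) and a kill
  at width `w'` kills every `w ≤ w'`.
* §1 the BASIS restriction is load-bearing: `constantBand_false_without_basis` — one unbounded fan-in gate
  computes CLIQUE_k exactly (size 1, band error 0), false already at `c = 0`.
* §2 the CENTRALITY window is load-bearing: `constantBand_false_without_central` — at the top slice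
  `j = C(n,2)` the OR of all edges (size ≤ C(n,2) ≤ n²) is EXACT on the whole band once `n ≥ k + 2w`
  (`cliqueFn_eq_true_of_card_false_le`: ≤ w missing edges leave a k-clique), false at `c = 3`.
  (Informal complement, not formalised: at the bottom, `j = 0`, the gate-free circuit `x_e` has band error
  `Σ_{i ≤ w} (i/C(n,2) + P[K_k ⊆ G(n,i)]) → 0`, false at `c = 0`; more generally for ANY window a.a.s. off the
  k-clique threshold CLIQUE_k is a.a.s. constant on the band and `x_e` (subcritical) or an OR of
  `⌈(C(n,2)/j)·log(2(2w+1)/δ)⌉ ≤ n²` edges (supercritical) is δ-accurate: the critical window is the ONLY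
  window where the statement can hold.)
* §3 the witness `k` must grow with `c`: `not_bandLB_of_le` — for `2 ≤ k`, `k + 3 ≤ c`, `0 ≤ δ` the exact
  monotone DNF (size ≤ C(n,k)·C(n,2) + C(n,k) ≤ n^{k+3}) refutes `BandLB c k w δ`; hence the natural
  strengthening "one `k` for all `c`" is FALSE (`not_exists_k_forall_c`) and in any proof `c ≤ k + 2`
  (`le_of_bandLB`). Any proof must therefore send `k → ∞` with `c` — consistent with the expected truth
  `|C| ≥ n^{k/4 - O(1)}` and Rossman's upper bound `n^{k/4 + O(1)}` (`Rossman2010_upperBound`, Thm 3).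
* §4 the δ-FLOOR (quantitative, every `c`): `not_bandLB_of_delta_gt` — for `k ≥ 3`, if
  `δ > (2w+1)/k!` then `BandLB c k w δ` is FALSE: the gate-free projection `x_{e₀}` is δ-accurate on every
  central band eventually. Ingredients: `card_slice` (`#slice_i = C(C(n,2),i)`), the hypergeometric tail
  `card_slice_filter_supset_mul_le` (`P_i[F ⊆ x] ≤ (i/C(n,2))^{|F|}`), the first-moment bound
  `errFrac_input_le` (`errfrac_i(x_{e₀}) ≤ i/N + C(n,k)(i/N)^{C(k,2)}`), the window bookkeeping
  `le_T_mul_bfac` (`i ≤ T(1 + T^{-1/4} + w/T)`, `T = C(n,2)n^{-2/(k-1)} ≥ (n-1)/2`) and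
  `choose_mul_θ_pow_le` (`C(n,k)·n^{-2C(k,2)/(k-1)} ≤ 1/k!`); `tendsto_Bnd`: the bound `→ 1/k!`.
  COROLLARY `delta_le_of_bandLB`: every witness `(k, w, δ)` of the crux has `δ ≤ (2w+1)/k!` — the accuracy
  demanded must shrink factorially in `k` while (§3) `k ≥ c - 2` must grow: a proof of `ConstantBand` at
  exponent `c` is a statement about `(c-2)!^{-1}`-accurate circuits at the least.
* §4b `not_withoutCentral_zero` — the BOTTOM window: without centrality, at `j = 0` the circuit `x_{e₀}` has band
  error `≤ (w+1)(θ·w/T + (w/T)^{C(k,2)}/k!) → 0`, so `ConstantBandWithoutCentral` fails already at `c = 0`; the window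
  is load-bearing at both ends.

* §5 BAND PSEUDO-COMPLEMENTS (Berkowitz with slack `w`): `band_pseudoComplement` — on the band the negation of a
  threshold `T_{≥t}` of the on-edges INSIDE any edge set `S` is sandwiched between the monotone thresholds
  `T_{≥ j+w+1-t}` and `T_{≥ j-w+1-t}` of the on-edges OUTSIDE `S` (`slice_pseudoComplement`: equality at `w = 0`).
  So the band hands monotone circuits approximate negations of every count whose scale exceeds `w` and withholds
  only negation at scale `≤ w` (single edges, bounded patterns): THAT is the whole difference between rung #3 and
  X = `SliceTarget` (where monotone = general), sharper than "no pseudo-complements on two adjacent slices".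

WHY IT RESISTS (numbers, not adjectives):
* By §0 a disproof is a uniform-exponent AVERAGE-CASE UPPER BOUND: size-`n^c` monotone circuits, `c` fixed,
  δ-approximating k-CLIQUE on `2w+1` adjacent critical slices for every `k`. The best circuits known that are
  a.a.s. correct at the threshold have size `n^{k/4+O(1)}` (Rossman 2010 Thm 3 = Amano 2010, monotonised),
  and clique enumeration is stuck at the same exponent: the expected number of `i`-cliques of the critical
  graph is `n^{i(k-i)/(k-1)}/i!`, maximal `≈ n^{k/4}` at `i = k/2`. No `n^{o(k)}` average-case detector at
  `p = n^{-2/(k-1)}` is known even for unrestricted algorithms (Rossman FOCS'10 §9 conjectures `n^{Ω(k)}`).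
* Trivial circuits do not slip under δ: on every central slice `P[CLIQUE_k = 1] → 1 - e^{-1/k!}`
  (`0.154, 0.041, 0.0083, 0.0014` for `k = 3,4,5,6`) and `P[CLIQUE_k = 0] → e^{-1/k!}`, uniformly over
  `|j - m| ≤ m^{3/4}` (the clique density `(j/C(n,2))^{C(k,2)}` moves by a factor `(1 ± m^{-1/4})^{C(k,2)} → 1`),
  so near-constant circuits have band error `→ (2w+1)·min(1 - e^{-1/k!}, e^{-1/k!}) > 0` and `δ` is chosen
  AFTER `k, w`.
* Conversely the crux implies Rossman's open single-threshold problem (`BandImpliesThreshold`, item 2839),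
  so a PROOF is at least as hard as that; the disprover's side is the algorithmic one above.
* No catalogued barrier bites a kill: `Literature/Barriers/PneNP/{MonotoneGap, ApproximationMethodLimit,
  NaturalProofs}` constrain lower-bound PROOFS, not upper bounds; `ledger negatives --problem PneNP` has no
  clique/threshold entry.

NEXT REGIMES (for later cycles): (i) formal bottom-window lemma (`x_e` at `j = 0`; the counting tools of §4
now make it a corollary: errfrac_i ≤ i/N + C(n,k)(i/N)^{C(k,2)} with `i ≤ w`); (ii) the `k = 3` corner: is `BandLB 2 3 w δ` already false (sub-cubic average-case
monotone triangle detection at `m ≈ n/2`)? — irrelevant to the crux (`∃ k`) but calibrates the method;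
(iii) watch crux #2's lines (two-round exposure): any NoisyThm1-type closure lemma proved there transfers here.
-/

set_option linter.dupNamespace false

namespace Summit.PneNP.PneNP.Cruxes.ConstantBand.Disproof

open Literature.Computability.Complexity Filter Finset Classical
open Summit.PneNP.PneNP.Theses.OneSlice (ConstantBand)

/-- The edge-variable type of `K_n`. [folklore] -/
abbrev Edge (n : ℕ) : Type := ((⊤ : SimpleGraph (Fin n)).edgeSet)

/-! ## §0 Vocabulary, bridge and monotonicity -/

/-- The `k`-clique threshold edge count `m_k(n) = ⌊C(n,2) · n^{-2/(k-1)}⌋₊` of the crux. [folklore] -/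
noncomputable def thr (k n : ℕ) : ℕ :=
  ⌊((n.choose 2 : ℕ) : ℝ) * (n : ℝ) ^ (-(2 : ℝ) / ((k : ℝ) - 1))⌋₊

/-- Centrality of an edge count `j`: `|j - m_k(n)| ≤ m_k(n)^{3/4}`. [folklore] -/
def Central (k n j : ℕ) : Prop :=
  |(j : ℝ) - (thr k n : ℝ)| ≤ (thr k n : ℝ) ^ ((3 : ℝ) / 4)

/-- The threshold itself is central. [folklore] -/
theorem central_thr (k n : ℕ) : Central k n (thr k n) := by
  simp only [Central, sub_self, abs_zero]
  exact Real.rpow_nonneg (Nat.cast_nonneg _) _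

/-- The Hamming slice of edge count `i`. [folklore] -/
noncomputable def slice (n i : ℕ) : Finset (Edge n → Bool) :=
  univ.filter fun x => edgeCount x = i

/-- The error set of `C` against `CLIQUE_k` on the slice `i`. [folklore] -/
noncomputable def errSet (n k i : ℕ) (C : Circuit (Edge n)) : Finset (Edge n → Bool) :=
  univ.filter fun x => edgeCount x = i ∧ C.eval x ≠ cliqueFn n k x

/-- The band error: the sum over `i ∈ [j-w, j+w]` of the error fractions on the slices. [folklore] -/
noncomputable def bandErr (n k j w : ℕ) (C : Circuit (Edge n)) : ℝ :=
  ∑ i ∈ Icc (j - w) (j + w), (#(errSet n k i C) : ℝ) / (#(slice n i) : ℝ)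

/-- The crux at fixed parameters: eventually in `n`, every monotone circuit that is `δ`-accurate on the
band of width `w` around a central `j` has more than `n^c` gates. [folklore] -/
def BandLB (c k w : ℕ) (δ : ℝ) : Prop :=
  ∀ᶠ n : ℕ in atTop, ∀ j : ℕ, Central k n j → ∀ C : Circuit (Edge n), C.IsOver monotoneBasis →
    bandErr n k j w C ≤ δ → n ^ c < C.size

/-- **Bridge.** The crux is `∀ c, ∃ k ≥ 3, ∃ w, ∃ δ > 0, BandLB c k w δ` — definitionally: the inline
clique function is `cliqueFn`, the inline edge count is `edgeCount`. [folklore] -/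
theorem constantBand_iff :
    ConstantBand ↔ ∀ c : ℕ, ∃ k : ℕ, 3 ≤ k ∧ ∃ w : ℕ, ∃ δ : ℝ, 0 < δ ∧ BandLB c k w δ :=
  Iff.rfl

/-- Negation of the schedule form. [folklore] -/
theorem not_bandLB_iff {c k w : ℕ} {δ : ℝ} :
    ¬ BandLB c k w δ ↔ ∃ᶠ n : ℕ in atTop, ∃ j : ℕ, Central k n j ∧ ∃ C : Circuit (Edge n),
      C.IsOver monotoneBasis ∧ bandErr n k j w C ≤ δ ∧ C.size ≤ n ^ c := by
  rw [BandLB, not_eventually]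
  constructor
  · intro h
    refine h.mono fun n hn => ?_
    by_contra hcon
    apply hn
    intro j hj C hC herr
    by_contra hlt
    exact hcon ⟨j, hj, C, hC, herr, not_lt.1 hlt⟩
  · intro h
    refine h.mono fun n hn hall => ?_
    obtain ⟨j, hj, C, hC, herr, hs⟩ := hn
    exact absurd (hall j hj C hC herr) (not_lt.2 hs)

/-- **What a kill must deliver**: one exponent `c` and, for EVERY `k ≥ 3`, `w`, `δ > 0`, infinitely many
`n` with a monotone circuit of size `≤ n^c` that is `δ`-accurate on a band around a central `j`. [folklore] -/
theorem not_constantBand_iff :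
    ¬ ConstantBand ↔ ∃ c : ℕ, ∀ k : ℕ, 3 ≤ k → ∀ w : ℕ, ∀ δ : ℝ, 0 < δ →
      ∃ᶠ n : ℕ in atTop, ∃ j : ℕ, Central k n j ∧ ∃ C : Circuit (Edge n), C.IsOver monotoneBasis ∧
        bandErr n k j w C ≤ δ ∧ C.size ≤ n ^ c := by
  rw [constantBand_iff]
  push Not
  simp only [not_bandLB_iff]

/-- Band errors are nonnegative. [folklore] -/
theorem bandErr_nonneg (n k j w : ℕ) (C : Circuit (Edge n)) : 0 ≤ bandErr n k j w C :=
  sum_nonneg fun _ _ => div_nonneg (Nat.cast_nonneg _) (Nat.cast_nonneg _)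

/-- The band error grows with the width. [folklore] -/
theorem bandErr_mono_width {n k j w w' : ℕ} (h : w ≤ w') (C : Circuit (Edge n)) :
    bandErr n k j w C ≤ bandErr n k j w' C := by
  apply sum_le_sum_of_subset_of_nonneg
  · intro i hi
    simp only [mem_Icc] at hi ⊢
    omega
  · intro i _ _
    exact div_nonneg (Nat.cast_nonneg _) (Nat.cast_nonneg _)

/-- Wider band = weaker claim: `BandLB` is monotone in `w`. [folklore] -/
theorem BandLB.mono_width {c k w w' : ℕ} {δ : ℝ} (h : w ≤ w') (H : BandLB c k w δ) :
    BandLB c k w' δ := by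
  filter_upwards [H] with n hn j hj C hC herr
  exact hn j hj C hC ((bandErr_mono_width h C).trans herr)

/-- Smaller `δ` = weaker claim: `BandLB` is antitone in `δ`. [folklore] -/
theorem BandLB.anti_delta {c k w : ℕ} {δ δ' : ℝ} (h : δ' ≤ δ) (H : BandLB c k w δ) :
    BandLB c k w δ' := by
  filter_upwards [H] with n hn j hj C hC herr
  exact hn j hj C hC (herr.trans h)

/-- Smaller exponent = weaker claim: `BandLB` is antitone in `c`. [folklore] -/
theorem BandLB.anti_exp {c c' k w : ℕ} {δ : ℝ} (h : c' ≤ c) (H : BandLB c k w δ) :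
    BandLB c' k w δ := by
  filter_upwards [H, eventually_ge_atTop 1] with n hn h1 j hj C hC herr
  exact lt_of_le_of_lt (Nat.pow_le_pow_right h1 h) (hn j hj C hC herr)

/-- `∃ w` may be read "for all large `w`". [folklore] -/
theorem constantBand_iff_eventually_width :
    ConstantBand ↔ ∀ c : ℕ, ∃ k : ℕ, 3 ≤ k ∧ ∃ δ : ℝ, 0 < δ ∧ ∀ᶠ w : ℕ in atTop, BandLB c k w δ := by
  rw [constantBand_iff]
  refine forall_congr' fun c => exists_congr fun k => and_congr_right fun _ => ?_
  constructor
  · rintro ⟨w, δ, hδ, H⟩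
    exact ⟨δ, hδ, eventually_atTop.2 ⟨w, fun w' hw' => H.mono_width hw'⟩⟩
  · rintro ⟨δ, hδ, H⟩
    obtain ⟨w, hw⟩ := H.exists
    exact ⟨w, δ, hδ, hw⟩

/-- A circuit that agrees with `CLIQUE_k` everywhere has band error `0`. [folklore] -/
theorem bandErr_eq_zero_of_eval {n k j w : ℕ} {C : Circuit (Edge n)}
    (h : ∀ x, edgeCount x ∈ Icc (j - w) (j + w) → C.eval x = cliqueFn n k x) :
    bandErr n k j w C = 0 := by
  apply sum_eq_zero
  intro i hi
  have : errSet n k i C = ∅ := by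
    refine filter_eq_empty_iff.2 fun x _ hx => hx.2 (h x ?_)
    rw [hx.1]
    exact hi
  simp [this]

/-! ## §1 The basis restriction `C.IsOver monotoneBasis` is load-bearing -/

/-- The crux with the basis hypothesis dropped (arbitrary gates of arbitrary fan-in). [folklore] -/
def ConstantBandWithoutBasis : Prop :=
  ∀ c : ℕ, ∃ k : ℕ, 3 ≤ k ∧ ∃ w : ℕ, ∃ δ : ℝ, 0 < δ ∧ ∀ᶠ n : ℕ in atTop, ∀ j : ℕ, Central k n j →
    ∀ C : Circuit (Edge n), bandErr n k j w C ≤ δ → n ^ c < C.size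

/-- One unbounded fan-in gate (truth table = `CLIQUE_k`) computes `CLIQUE_k` with a single gate. [folklore] -/
theorem exists_oneGate_cliqueFn (n k : ℕ) :
    ∃ C : Circuit (Edge n), C.size ≤ 1 ∧ ∀ x, C.eval x = cliqueFn n k x := by
  let N := Fintype.card (Edge n)
  let eqv : Edge n ≃ Fin N := Fintype.equivFin _
  let g : GateFn := ⟨N, fun v => cliqueFn n k fun e => v (eqv e)⟩
  obtain ⟨C, -, hs, he⟩ :=
    (CktSize.gate (B := Set.univ) g (Set.mem_univ _) fun a => eqv.symm a).toCircuit
  refine ⟨C, hs, fun x => ?_⟩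
  rw [he x]
  show cliqueFn n k (fun e => x (eqv.symm (eqv e))) = _
  simp

/-- **The basis restriction is load-bearing**: without it the crux fails at `c = 0`. [folklore] -/
theorem constantBand_false_without_basis : ¬ ConstantBandWithoutBasis := by
  intro h
  obtain ⟨k, -, w, δ, hδ, hev⟩ := h 0
  obtain ⟨n, hn⟩ := hev.exists
  obtain ⟨C, hs, he⟩ := exists_oneGate_cliqueFn n k
  have hlt := hn (thr k n) (central_thr k n) C
    (by rw [bandErr_eq_zero_of_eval fun x _ => he x]; exact hδ.le)
  simp only [pow_zero] at hlt
  omega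

/-! ## §2 The centrality window is load-bearing (top end: `j = C(n,2)`) -/

/-- The crux with the centrality hypothesis dropped (every edge count `j`). [folklore] -/
def ConstantBandWithoutCentral : Prop :=
  ∀ c : ℕ, ∃ k : ℕ, 3 ≤ k ∧ ∃ w : ℕ, ∃ δ : ℝ, 0 < δ ∧ ∀ᶠ n : ℕ in atTop, ∀ j : ℕ,
    ∀ C : Circuit (Edge n), C.IsOver monotoneBasis → bandErr n k j w C ≤ δ → n ^ c < C.size

/-- An unordered pair has at most two members. [folklore] -/
theorem card_filter_mem_sym2_le {n : ℕ} (e : Sym2 (Fin n)) :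
    #(univ.filter fun v : Fin n => v ∈ e) ≤ 2 := by
  induction e using Sym2.ind with
  | h a b =>
    calc #(univ.filter fun v : Fin n => v ∈ s(a, b)) ≤ #({a, b} : Finset (Fin n)) := by
          apply card_le_card
          intro v hv
          simp only [mem_filter, mem_univ, true_and, Sym2.mem_iff] at hv
          rcases hv with rfl | rfl <;> simp
      _ ≤ 2 := card_le_two

/-- **Few missing edges leave a clique.** If at most `t` edges of `K_n` are off in `x` and `k + 2t ≤ n`,
then the graph of `x` contains a `k`-clique (delete both endpoints of every missing edge). [folklore] -/
theorem cliqueFn_eq_true_of_card_false_le {n k t : ℕ} (x : Edge n → Bool)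
    (ht : #(univ.filter fun e : Edge n => x e = false) ≤ t) (hn : k + 2 * t ≤ n) :
    cliqueFn n k x = true := by
  rw [cliqueFn_eq_true_iff]
  set M : Finset (Edge n) := univ.filter fun e : Edge n => x e = false with hM
  set B : Finset (Fin n) := M.biUnion fun e => univ.filter fun v : Fin n => v ∈ (e : Sym2 (Fin n))
    with hB
  have hBcard : #B ≤ 2 * t := by
    calc #B ≤ ∑ e ∈ M, #(univ.filter fun v : Fin n => v ∈ (e : Sym2 (Fin n))) := card_biUnion_le
      _ ≤ ∑ _e ∈ M, 2 := sum_le_sum fun e _ => card_filter_mem_sym2_le (e : Sym2 (Fin n))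
      _ = 2 * #M := by rw [sum_const, smul_eq_mul, mul_comm]
      _ ≤ 2 * t := by omega
  -- the complement of `B` is a clique
  have hclique : (cliqueGraph x).IsClique ((Bᶜ : Finset (Fin n)) : Set (Fin n)) := by
    intro u hu v hv huv
    rw [cliqueGraph_adj]
    refine ⟨huv, ?_⟩
    by_contra hx
    have hmem : (⟨s(u, v), by simpa using huv⟩ : Edge n) ∈ M :=
      mem_filter.2 ⟨mem_univ _, by simpa using hx⟩
    have huB : u ∈ B :=
      mem_biUnion.2 ⟨_, hmem, mem_filter.2 ⟨mem_univ _, Sym2.mem_mk_left u v⟩⟩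
    exact (mem_compl.1 (mem_coe.1 hu)) huB
  have hcard : k ≤ #(Bᶜ) := by
    rw [card_compl, Fintype.card_fin]
    omega
  obtain ⟨T, hT, hTk⟩ := exists_subset_card_eq hcard
  intro hfree
  exact hfree T ⟨hclique.subset (by exact_mod_cast hT), hTk⟩

/-- `a ≤ C(n,2)` once `a ≤ n` and `n ≥ 3`. [folklore] -/
theorem le_choose_two {a n : ℕ} (ha : a ≤ n) (hn : 3 ≤ n) : a ≤ n.choose 2 := by
  rw [Nat.choose_two_right]
  apply (Nat.le_div_iff_mul_le (by norm_num)).2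
  exact Nat.mul_le_mul ha (by omega)

/-- The OR of all edges: a monotone circuit of size `≤ C(n,2)` that is `1` iff some edge is on. [folklore] -/
theorem exists_orAll (n : ℕ) (hn : 2 ≤ n) :
    ∃ C : Circuit (Edge n), C.IsOver monotoneBasis ∧ C.size ≤ n.choose 2 ∧
      ∀ x, C.eval x = true ↔ ∃ e, x e = true := by
  have hne : (univ : Finset (Edge n)).toList ≠ [] := by
    intro hnil
    have h0 : Fintype.card (Edge n) = 0 := by
      rw [← card_univ, ← Finset.length_toList, hnil, List.length_nil]
    rw [card_edgeSet_top_fin] at h0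
    have : 0 < n.choose 2 := Nat.choose_pos hn
    omega
  obtain ⟨C, hCB, hs, he⟩ := (cktSize_any (univ : Finset (Edge n)).toList hne).toCircuit
  refine ⟨C, hCB, ?_, fun x => ?_⟩
  · rwa [Finset.length_toList, card_univ, card_edgeSet_top_fin] at hs
  · rw [he x, List.any_eq_true]
    simp

/-- **The centrality window is load-bearing**: without it the crux fails at `c = 3` — at the top edge
count `j = C(n,2)` the OR of all edges is exact on the whole band `[C(n,2) - w, C(n,2) + w]` once
`n ≥ k + 2w`, and has `≤ C(n,2) ≤ n² < n³` gates. [folklore] -/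
theorem constantBand_false_without_central : ¬ ConstantBandWithoutCentral := by
  intro h
  obtain ⟨k, hk, w, δ, hδ, hev⟩ := h 3
  obtain ⟨n, hn, hnk⟩ := (hev.and (eventually_ge_atTop (k + 2 * w + 2))).exists
  obtain ⟨C, hCB, hs, he⟩ := exists_orAll n (by omega)
  have hN : Fintype.card (Edge n) = n.choose 2 := card_edgeSet_top_fin n
  -- on the band around the top slice the OR of all edges is exact
  have hexact : ∀ x : Edge n → Bool, edgeCount x ∈ Icc (n.choose 2 - w) (n.choose 2 + w) →
      C.eval x = cliqueFn n k x := by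
    intro x hx
    rw [mem_Icc] at hx
    have hwN : w + 1 ≤ n.choose 2 := le_choose_two (by omega) (by omega)
    have hfalse : #(univ.filter fun e : Edge n => x e = false) ≤ w := by
      have h := card_filter_eq_false x
      have h' : (univ.filter fun e : Edge n => ¬ x e = true) = univ.filter fun e : Edge n => x e = false := by
        congr 1; ext e; simp
      rw [h'] at h
      rw [h]
      omega
    have h1 : cliqueFn n k x = true := cliqueFn_eq_true_of_card_false_le x hfalse (by omega)
    have h2 : C.eval x = true := by
      rw [he x]
      by_contra hno
      push Not at hno
      have : edgeCount x = 0 := by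
        rw [edgeCount, card_eq_zero, filter_eq_empty_iff]
        intro e _
        simpa using hno e
      omega
    rw [h1, h2]
  have hlt := hn (n.choose 2) C hCB (by rw [bandErr_eq_zero_of_eval hexact]; exact hδ.le)
  have h2 : n.choose 2 ≤ n ^ 2 := Nat.choose_le_pow n 2
  have h3 : n ^ 2 < n ^ 3 := Nat.pow_lt_pow_right (by omega) (by norm_num)
  omega

/-! ## §3 The witness `k` must grow with `c` (exact DNF; "one `k` for all `c`" is false) -/

/-- **The monotone DNF with its size.** For `2 ≤ k ≤ n` the OR over all `k`-sets of the AND of their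
edges is a circuit over `{∧₂, ∨₂}` of size `≤ C(n,k)·C(n,2) + C(n,k)` computing `CLIQUE_k` exactly
(the construction of `exists_monotone_computes_cliqueFn_holds`, with the gate count kept). [folklore] -/
theorem exists_exact_monotone_cliqueFn {n k : ℕ} (h2 : 2 ≤ k) (hkn : k ≤ n) :
    ∃ C : Circuit (Edge n), C.IsOver monotoneBasis ∧
      C.size ≤ n.choose k * n.choose 2 + n.choose k ∧ ∀ x, C.eval x = cliqueFn n k x := by
  set T : Finset (Finset (Fin n)) := powersetCard k univ with hT
  let E : Finset (Fin n) → List (Edge n) := fun S => (univ.filter fun e => IsLive S e).toList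
  have hEne : ∀ S ∈ T, E S ≠ [] := by
    intro S hS
    have hScard : #S = k := (mem_powersetCard.1 hS).2
    obtain ⟨u, hu, v, hv, huv⟩ := one_lt_card.1 (by omega : 1 < #S)
    have he : s(u, v) ∈ (⊤ : SimpleGraph (Fin n)).edgeSet := (SimpleGraph.mem_edgeSet _).2 huv
    intro hnil
    have : (⟨s(u, v), he⟩ : Edge n) ∈ E S :=
      Finset.mem_toList.2 (mem_filter.2 ⟨mem_univ _, (isLive_mk he).2 ⟨hu, hv⟩⟩)
    rw [hnil] at this
    simp at this
  have hTne : T.toList ≠ [] := by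
    intro hnil
    have hne : T.Nonempty := powersetCard_nonempty.2 (by simpa using hkn)
    obtain ⟨S, hS⟩ := hne
    have := Finset.mem_toList.2 hS
    rw [hnil] at this
    simp at this
  have hElen : ∀ S, (E S).length ≤ n.choose 2 := by
    intro S
    show (Finset.toList _).length ≤ _
    rw [Finset.length_toList, ← card_edgeSet_top_fin n, ← card_univ]
    exact card_le_card (filter_subset _ _)
  -- stage 1: all the ANDs in parallel
  have h1 : CktSize monotoneBasis
      (fun (x : Edge n → Bool) (S : T) => (E S).all fun e => x e) (∑ S : T, (E S).length) :=
    CktSize.pi fun S => cktSize_all (E S) (hEne S S.2)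
  -- stage 2: the OR of the results
  have hUne : (univ : Finset T).toList ≠ [] := by
    intro hnil
    obtain ⟨S, hS⟩ := List.exists_mem_of_ne_nil T.toList hTne
    have := Finset.mem_toList.2 (mem_univ (⟨S, Finset.mem_toList.1 hS⟩ : T))
    rw [hnil] at this
    simp at this
  have h12 := h1.comp (cktSize_any (ι := T) (univ : Finset T).toList hUne)
  obtain ⟨C, hCB, hs, hCev⟩ := h12.toCircuit
  refine ⟨C, hCB, hs.trans ?_, fun x => ?_⟩
  · -- size bookkeeping
    have hTcard : Fintype.card T = n.choose k := by
      rw [Fintype.card_coe, hT, card_powersetCard, card_univ, Fintype.card_fin]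
    have hsum : ∑ S : T, (E S).length ≤ n.choose k * n.choose 2 :=
      calc ∑ S : T, (E S).length ≤ ∑ _S : T, n.choose 2 := sum_le_sum fun S _ => hElen S
        _ = n.choose k * n.choose 2 := by rw [sum_const, smul_eq_mul, card_univ, hTcard]
    have hlen : (univ : Finset T).toList.length = n.choose k := by
      rw [Finset.length_toList, card_univ, hTcard]
    omega
  · rw [hCev]
    apply Bool.eq_iff_iff.2
    rw [cliqueFn_eq_true_iff_exists, List.any_eq_true]
    constructor
    · rintro ⟨S, -, hS⟩
      rw [List.all_eq_true] at hS
      refine ⟨S, (mem_powersetCard.1 S.2).2, fun e he => hS e ?_⟩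
      exact Finset.mem_toList.2 (mem_filter.2 ⟨mem_univ _, he⟩)
    · rintro ⟨S, hS, hx⟩
      have hST : S ∈ T := mem_powersetCard.2 ⟨subset_univ _, hS⟩
      refine ⟨⟨S, hST⟩, Finset.mem_toList.2 (mem_univ _), ?_⟩
      rw [List.all_eq_true]
      intro e he
      exact hx e (mem_filter.1 (Finset.mem_toList.1 he)).2

/-- The hypothesis class of the crux is inhabited at every `n ≥ k ≥ 2`: some monotone circuit has band
error `0` (so the crux is not vacuously true; its content is the size bound). [folklore] -/
theorem exists_monotone_bandErr_zero {n k : ℕ} (h2 : 2 ≤ k) (hkn : k ≤ n) (j w : ℕ) :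
    ∃ C : Circuit (Edge n), C.IsOver monotoneBasis ∧ bandErr n k j w C = 0 ∧
      C.size ≤ n.choose k * n.choose 2 + n.choose k := by
  obtain ⟨C, hCB, hs, he⟩ := exists_exact_monotone_cliqueFn h2 hkn
  exact ⟨C, hCB, bandErr_eq_zero_of_eval fun x _ => he x, hs⟩

/-- **Small `k` is refuted by brute force**: for `2 ≤ k`, `k + 3 ≤ c` and any `δ ≥ 0`, `BandLB c k w δ`
is FALSE (the exact DNF has `≤ C(n,k)·C(n,2) + C(n,k) ≤ 2 n^{k+2} < n^{k+3} ≤ n^c` gates). [folklore] -/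
theorem not_bandLB_of_le {c k w : ℕ} {δ : ℝ} (h2 : 2 ≤ k) (hc : k + 3 ≤ c) (hδ : 0 ≤ δ) :
    ¬ BandLB c k w δ := by
  intro H
  obtain ⟨n, hn, hnk⟩ := (H.and (eventually_ge_atTop (k + 3))).exists
  obtain ⟨C, hCB, hs, he⟩ := exists_exact_monotone_cliqueFn h2 (by omega : k ≤ n)
  have hlt := hn (thr k n) (central_thr k n) C hCB
    (by rw [bandErr_eq_zero_of_eval fun x _ => he x]; exact hδ)
  -- `C(n,k)·C(n,2) + C(n,k) ≤ n^k n^2 + n^k ≤ 2 n^(k+2) ≤ n^(k+3) ≤ n^c`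
  have hk' : n.choose k ≤ n ^ k := Nat.choose_le_pow n k
  have h2' : n.choose 2 ≤ n ^ 2 := Nat.choose_le_pow n 2
  have hA : n.choose k * n.choose 2 + n.choose k ≤ n ^ k * n ^ 2 + n ^ k :=
    add_le_add (Nat.mul_le_mul hk' h2') hk'
  have hB : n ^ k * n ^ 2 + n ^ k ≤ 2 * n ^ (k + 2) := by
    rw [pow_add]
    have : n ^ k ≤ n ^ k * n ^ 2 := Nat.le_mul_of_pos_right _ (Nat.pow_pos (by omega))
    omega
  have hC : 2 * n ^ (k + 2) ≤ n ^ (k + 3) := by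
    rw [show n ^ (k + 3) = n ^ (k + 2) * n from pow_succ n (k + 2), mul_comm]
    exact Nat.mul_le_mul_left _ (by omega)
  have hD : n ^ (k + 3) ≤ n ^ c := Nat.pow_le_pow_right (by omega) hc
  omega

/-- **The natural strengthening "one `k` for every `c`" is FALSE.** [folklore] -/
theorem not_exists_k_forall_c :
    ¬ ∃ k : ℕ, 3 ≤ k ∧ ∀ c : ℕ, ∃ w : ℕ, ∃ δ : ℝ, 0 < δ ∧ BandLB c k w δ := by
  rintro ⟨k, hk, h⟩
  obtain ⟨w, δ, hδ, H⟩ := h (k + 3)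
  exact not_bandLB_of_le (by omega) le_rfl hδ.le H

/-- **In any proof the exponent is at most `k + 2`**: a witness `(k, w, δ)` for `c` has `c ≤ k + 2`. [folklore] -/
theorem le_of_bandLB {c k w : ℕ} {δ : ℝ} (hk : 2 ≤ k) (hδ : 0 ≤ δ) (H : BandLB c k w δ) :
    c ≤ k + 2 := by
  by_contra hc
  exact not_bandLB_of_le hk (by omega) hδ H

/-! ## §4 The δ-floor: `δ > (2w+1)/k!` is refuted by the gate-free circuit `x_e` (every `c`)

On a central slice the clique density is `≤ (1+o(1))/k!` (first moment, hypergeometric) and a fixed edge is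
on with probability `i/C(n,2) → 0`, so the projection `x_e` (0 gates) has band error `≤ (2w+1)/k! + o(1)`:
in any witness `(k, w, δ)` of the crux NECESSARILY `δ ≤ (2w+1)/k!` — the accuracy demanded must shrink
like `1/k!` (the true floor for near-constant circuits is `(2w+1)(1 - e^{-1/k!})`, second moment not done here). -/

section DeltaFloor

open Literature.Combinatorics.SetFamily (finsetEquivFun mem_finsetEquivFun_symm)
open scoped Topology

variable {n : ℕ}

/-- The set attached to a Boolean edge vector is its on-set. [folklore] -/
theorem finsetEquivFun_symm_eq (x : Edge n → Bool) :
    finsetEquivFun.symm x = univ.filter fun e => x e = true := by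
  ext e
  simp

/-- `#slice_i = C(C(n,2), i)`. [folklore] -/
theorem card_slice (n i : ℕ) : #(slice n i) = (n.choose 2).choose i := by
  rw [← card_edgeSet_top_fin n, ← card_univ, ← card_powersetCard]
  refine card_equiv (finsetEquivFun (α := Edge n)).symm fun x => ?_
  simp only [slice, mem_filter, mem_univ, true_and, mem_powersetCard, subset_univ, edgeCount,
    finsetEquivFun_symm_eq]

/-- The vectors of a slice switching on a fixed edge set `F` number `C(C(n,2) - |F|, i - |F|)`
(hypergeometric count). [folklore] -/
theorem card_slice_filter_supset (F : Finset (Edge n)) {i : ℕ} (hF : #F ≤ i) :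
    #((slice n i).filter fun x => ∀ e ∈ F, x e = true) = (n.choose 2 - #F).choose (i - #F) := by
  rw [← card_edgeSet_top_fin n, ← card_univ (α := Edge n),
    ← Finset.card_filter_powersetCard_subset F univ i (subset_univ F) hF]
  refine card_equiv (finsetEquivFun (α := Edge n)).symm fun x => ?_
  simp only [slice, mem_filter, mem_univ, true_and, mem_powersetCard, subset_univ, edgeCount,
    finsetEquivFun_symm_eq]
  simp only [Finset.subset_iff, mem_filter, mem_univ, true_and]

/-- **Hypergeometric tail, product form**: `#{x ∈ slice_i : F ⊆ x} · C(n,2)^{|F|} ≤ i^{|F|} · #slice_i`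
(`i ≤ C(n,2)`), i.e. `P_i[F ⊆ x] ≤ (i / C(n,2))^{|F|}`. [folklore] -/
theorem card_slice_filter_supset_mul_le (F : Finset (Edge n)) {i : ℕ} (hi : i ≤ n.choose 2) :
    #((slice n i).filter fun x => ∀ e ∈ F, x e = true) * (n.choose 2) ^ #F ≤ i ^ #F * #(slice n i) := by
  by_cases hF : #F ≤ i
  · rw [card_slice_filter_supset F hF, card_slice]
    exact choose_sub_mul_pow_le_pow_mul_choose #F (n.choose 2) i hF hi
  · have h0 : (slice n i).filter (fun x => ∀ e ∈ F, x e = true) = ∅ := by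
      refine filter_eq_empty_iff.2 fun x hx hall => hF ?_
      rw [slice, mem_filter] at hx
      rw [← hx.2, edgeCount]
      exact card_le_card fun e he => mem_filter.2 ⟨mem_univ _, hall e he⟩
    rw [h0, card_empty, zero_mul]
    exact Nat.zero_le _

/-- The same as a fraction: `P_i[F ⊆ x] ≤ (i / C(n,2))^{|F|}`. [folklore] -/
theorem frac_slice_filter_supset_le (F : Finset (Edge n)) {i : ℕ} (hi : i ≤ n.choose 2)
    (hN : 0 < n.choose 2) :
    (#((slice n i).filter fun x => ∀ e ∈ F, x e = true) : ℝ) / #(slice n i) ≤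
      ((i : ℝ) / n.choose 2) ^ #F := by
  have hs : 0 < #(slice n i) := by rw [card_slice]; exact Nat.choose_pos hi
  have hN' : (0 : ℝ) < (n.choose 2 : ℝ) ^ #F := by positivity
  rw [div_le_iff₀ (by exact_mod_cast hs), div_pow, div_mul_eq_mul_div, le_div_iff₀ hN']
  exact_mod_cast card_slice_filter_supset_mul_le F hi

/-- The error set of the projection `x_{e₀}` on a slice: `x_{e₀} ≠ CLIQUE_k(x)` forces `x_{e₀} = 1` or a
`k`-clique. [folklore] -/
theorem errSet_input_subset (e₀ : Edge n) (k i : ℕ) :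
    errSet n k i (Circuit.input e₀) ⊆
      ((slice n i).filter fun x => ∀ e ∈ ({e₀} : Finset (Edge n)), x e = true) ∪
        (powersetCard k (univ : Finset (Fin n))).biUnion fun A =>
          (slice n i).filter fun x => ∀ e ∈ univ.filter (fun e => cliqueVec A e = true), x e = true := by
  intro x hx
  rw [errSet, mem_filter] at hx
  obtain ⟨-, hcount, hne⟩ := hx
  rw [Circuit.eval_input] at hne
  have hxs : x ∈ slice n i := mem_filter.2 ⟨mem_univ _, hcount⟩
  rw [mem_union]
  cases h0 : x e₀ with
  | true =>
    left
    exact mem_filter.2 ⟨hxs, by simpa using h0⟩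
  | false =>
    right
    have hcl : cliqueFn n k x = true := by
      cases h1 : cliqueFn n k x with
      | true => rfl
      | false => exact absurd (h0.trans h1.symm) hne
    obtain ⟨A, hA, hlive⟩ := (cliqueFn_eq_true_iff_exists k x).1 hcl
    refine mem_biUnion.2 ⟨A, mem_powersetCard.2 ⟨subset_univ _, hA⟩, mem_filter.2 ⟨hxs, ?_⟩⟩
    intro e he
    exact hlive e ((cliqueVec_eq_true_iff A e).1 (mem_filter.1 he).2)

/-- **First-moment bound on a slice**: the error fraction of `x_{e₀}` against `CLIQUE_k` on slice `i`
is at most `i/C(n,2) + C(n,k) · (i/C(n,2))^{C(k,2)}`. [folklore] -/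
theorem errFrac_input_le (e₀ : Edge n) {k i : ℕ} (hi : i ≤ n.choose 2) (hN : 0 < n.choose 2) :
    (#(errSet n k i (Circuit.input e₀)) : ℝ) / #(slice n i) ≤
      (i : ℝ) / n.choose 2 + (n.choose k : ℝ) * ((i : ℝ) / n.choose 2) ^ k.choose 2 := by
  have hs : 0 < (#(slice n i) : ℝ) := by
    rw [card_slice]; exact_mod_cast Nat.choose_pos hi
  set A₁ := (slice n i).filter fun x => ∀ e ∈ ({e₀} : Finset (Edge n)), x e = true with hA₁
  set B : Finset (Fin n) → Finset (Edge n → Bool) := fun A =>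
    (slice n i).filter fun x => ∀ e ∈ univ.filter (fun e => cliqueVec A e = true), x e = true with hB
  have hcard : #(errSet n k i (Circuit.input e₀)) ≤ #A₁ + ∑ A ∈ powersetCard k univ, #(B A) :=
    (card_le_card (errSet_input_subset e₀ k i)).trans
      ((card_union_le _ _).trans (add_le_add le_rfl card_biUnion_le))
  have h1 : (#A₁ : ℝ) / #(slice n i) ≤ (i : ℝ) / n.choose 2 := by
    have := frac_slice_filter_supset_le ({e₀} : Finset (Edge n)) hi hN
    rwa [card_singleton, pow_one] at this
  have h2 : ∀ A ∈ powersetCard k (univ : Finset (Fin n)),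
      (#(B A) : ℝ) / #(slice n i) ≤ ((i : ℝ) / n.choose 2) ^ k.choose 2 := by
    intro A hA
    have := frac_slice_filter_supset_le (univ.filter fun e => cliqueVec A e = true) hi hN
    rwa [card_filter_cliqueVec, (mem_powersetCard.1 hA).2] at this
  calc (#(errSet n k i (Circuit.input e₀)) : ℝ) / #(slice n i)
      ≤ ((#A₁ + ∑ A ∈ powersetCard k univ, #(B A) : ℕ) : ℝ) / #(slice n i) :=
        div_le_div_of_nonneg_right (by exact_mod_cast hcard) hs.le
    _ = (#A₁ : ℝ) / #(slice n i) + ∑ A ∈ powersetCard k univ, (#(B A) : ℝ) / #(slice n i) := by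
        push_cast
        rw [add_div, sum_div]
    _ ≤ (i : ℝ) / n.choose 2 + ∑ _A ∈ powersetCard k (univ : Finset (Fin n)),
          ((i : ℝ) / n.choose 2) ^ k.choose 2 := add_le_add h1 (sum_le_sum h2)
    _ = (i : ℝ) / n.choose 2 + (n.choose k : ℝ) * ((i : ℝ) / n.choose 2) ^ k.choose 2 := by
        rw [sum_const, card_powersetCard, card_univ, Fintype.card_fin, nsmul_eq_mul]

/-- The threshold density `θ_k(n) = n^{-2/(k-1)}`. [folklore] -/
noncomputable def θ (k n : ℕ) : ℝ := (n : ℝ) ^ (-(2 : ℝ) / ((k : ℝ) - 1))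

/-- The real threshold `T_k(n) = C(n,2) · n^{-2/(k-1)}` (so `thr k n = ⌊T_k(n)⌋₊`). [folklore] -/
noncomputable def T (k n : ℕ) : ℝ := (n.choose 2 : ℝ) * θ k n

/-- The window inflation factor `b = 1 + T^{-1/4} + w/T` (`→ 1`). [folklore] -/
noncomputable def bfac (k w n : ℕ) : ℝ := 1 + (T k n) ^ (-(1 / 4 : ℝ)) + (w : ℝ) / T k n

/-- The per-slice error bound `B = θ b + b^{C(k,2)}/k!` (`→ 1/k!`). [folklore] -/
noncomputable def Bnd (k w n : ℕ) : ℝ := θ k n * bfac k w n + (bfac k w n) ^ k.choose 2 / k.factorial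

/-- `thr = ⌊T⌋₊`. [folklore] -/
theorem thr_eq (k n : ℕ) : thr k n = ⌊T k n⌋₊ := rfl

/-- `θ > 0`. [folklore] -/
theorem θ_pos {k n : ℕ} (hn : 1 ≤ n) : 0 < θ k n :=
  Real.rpow_pos_of_pos (by exact_mod_cast hn) _

/-- `T ≥ 0`. [folklore] -/
theorem T_nonneg (k n : ℕ) : 0 ≤ T k n :=
  mul_nonneg (Nat.cast_nonneg _) (Real.rpow_nonneg (Nat.cast_nonneg _) _)

/-- `C(n,k) · θ^{C(k,2)} ≤ 1/k!` (`θ^{C(k,2)} = n^{-k}` and `C(n,k) ≤ n^k/k!`). [folklore] -/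
theorem choose_mul_θ_pow_le {k n : ℕ} (hk : 2 ≤ k) (hn : 1 ≤ n) :
    (n.choose k : ℝ) * (θ k n) ^ k.choose 2 ≤ 1 / k.factorial := by
  have hn0 : (0 : ℝ) < n := by exact_mod_cast hn
  have hk1 : (k : ℝ) - 1 ≠ 0 := by
    have : (2 : ℝ) ≤ k := by exact_mod_cast hk
    linarith
  have hθK : (θ k n) ^ k.choose 2 = ((n : ℝ) ^ k)⁻¹ := by
    rw [θ, ← Real.rpow_mul_natCast hn0.le, Nat.cast_choose_two, ← Real.rpow_natCast,
      ← Real.rpow_neg hn0.le]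
    congr 1
    field_simp
  have hchoose : (n.choose k : ℝ) ≤ (n : ℝ) ^ k / k.factorial := by
    have := Nat.choose_le_pow_div k n (α := ℝ)
    simpa using this
  rw [hθK]
  calc (n.choose k : ℝ) * ((n : ℝ) ^ k)⁻¹ ≤ (n : ℝ) ^ k / k.factorial * ((n : ℝ) ^ k)⁻¹ :=
        mul_le_mul_of_nonneg_right hchoose (by positivity)
    _ = 1 / k.factorial := by field_simp

/-- Window bookkeeping: for central `j` and `i ≤ j + w`, `i ≤ T + T^{3/4} + w = T · b` (`T > 0`). [folklore] -/
theorem le_T_mul_bfac {k w n j i : ℕ} (hj : Central k n j) (hi : i ≤ j + w) (hT : 0 < T k n) :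
    (i : ℝ) ≤ T k n * bfac k w n := by
  have hfl : (thr k n : ℝ) ≤ T k n := Nat.floor_le (T_nonneg k n)
  have hfl' : (thr k n : ℝ) ^ ((3 : ℝ) / 4) ≤ (T k n) ^ ((3 : ℝ) / 4) :=
    Real.rpow_le_rpow (Nat.cast_nonneg _) hfl (by norm_num)
  have hj' : (j : ℝ) ≤ thr k n + (thr k n : ℝ) ^ ((3 : ℝ) / 4) := by
    have := (abs_sub_le_iff.1 hj).1
    linarith
  have hi' : (i : ℝ) ≤ j + w := by exact_mod_cast hi
  have hexp : T k n * (T k n) ^ (-(1 / 4 : ℝ)) = (T k n) ^ ((3 : ℝ) / 4) := by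
    conv_lhs => rw [show T k n * (T k n) ^ (-(1 / 4 : ℝ)) = (T k n) ^ (1 : ℝ) * (T k n) ^ (-(1 / 4 : ℝ)) by
      rw [Real.rpow_one]]
    rw [← Real.rpow_add hT]
    norm_num
  have : T k n * bfac k w n = T k n + (T k n) ^ ((3 : ℝ) / 4) + w := by
    rw [bfac, mul_add, mul_add, mul_one, hexp, mul_div_cancel₀ _ hT.ne']
  rw [this]
  linarith

/-- **Per-slice bound at a large `n`**: if `T_k(n) > 0`, then for central `j`, `i ≤ j + w` and every edge
`e₀` the error fraction of `x_{e₀}` on slice `i` is `≤ B = θ b + b^{C(k,2)}/k!`. [folklore] -/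
theorem errFrac_input_le_Bnd {k w n j i : ℕ} (hk : 2 ≤ k) (hn : 2 ≤ n) (hT : 0 < T k n)
    (hj : Central k n j) (hi : i ≤ j + w) (e₀ : Edge n) :
    (#(errSet n k i (Circuit.input e₀)) : ℝ) / #(slice n i) ≤ Bnd k w n := by
  have hN : 0 < n.choose 2 := Nat.choose_pos hn
  have hθ : 0 < θ k n := θ_pos (by omega)
  have hb0 : 0 ≤ bfac k w n := by
    have h1 : 0 ≤ (T k n) ^ (-(1 / 4 : ℝ)) := Real.rpow_nonneg hT.le _
    have h2 : 0 ≤ (w : ℝ) / T k n := div_nonneg (Nat.cast_nonneg _) hT.le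
    rw [bfac]; linarith
  by_cases hiN : i ≤ n.choose 2
  · have hq : (i : ℝ) / n.choose 2 ≤ θ k n * bfac k w n := by
      rw [div_le_iff₀ (by exact_mod_cast hN)]
      have h := le_T_mul_bfac hj hi hT
      calc (i : ℝ) ≤ T k n * bfac k w n := h
        _ = θ k n * bfac k w n * n.choose 2 := by rw [T]; ring
    have hq0 : (0 : ℝ) ≤ (i : ℝ) / n.choose 2 := by positivity
    calc (#(errSet n k i (Circuit.input e₀)) : ℝ) / #(slice n i)
        ≤ (i : ℝ) / n.choose 2 + (n.choose k : ℝ) * ((i : ℝ) / n.choose 2) ^ k.choose 2 :=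
          errFrac_input_le e₀ hiN hN
      _ ≤ θ k n * bfac k w n + (n.choose k : ℝ) * (θ k n * bfac k w n) ^ k.choose 2 :=
          add_le_add hq (mul_le_mul_of_nonneg_left (pow_le_pow_left₀ hq0 hq _) (Nat.cast_nonneg _))
      _ = θ k n * bfac k w n + (n.choose k : ℝ) * (θ k n) ^ k.choose 2 * (bfac k w n) ^ k.choose 2 := by
          rw [mul_pow]; ring
      _ ≤ θ k n * bfac k w n + 1 / k.factorial * (bfac k w n) ^ k.choose 2 :=
          add_le_add le_rfl (mul_le_mul_of_nonneg_right (choose_mul_θ_pow_le (n := n) hk (by omega))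
            (pow_nonneg hb0 _))
      _ = Bnd k w n := by rw [Bnd]; ring
  · -- empty slice: the fraction is `0`
    have h0 : errSet n k i (Circuit.input e₀) = ∅ := by
      refine filter_eq_empty_iff.2 fun x _ hx => hiN ?_
      rw [← hx.1, edgeCount, ← card_edgeSet_top_fin n, ← card_univ]
      exact card_le_card (filter_subset _ _)
    rw [h0, card_empty, Nat.cast_zero, zero_div, Bnd]
    have : 0 ≤ θ k n * bfac k w n := mul_nonneg hθ.le hb0
    positivity

/-- `T_k(n) ≥ (n - 1)/2` for `k ≥ 3` (`n^{-2/(k-1)} ≥ n^{-1}`), so `T_k(n) → ∞`. [folklore] -/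
theorem T_ge {k n : ℕ} (hk : 3 ≤ k) (hn : 1 ≤ n) : ((n : ℝ) - 1) / 2 ≤ T k n := by
  have hn0 : (0 : ℝ) < n := by exact_mod_cast hn
  have hn1 : (1 : ℝ) ≤ n := by exact_mod_cast hn
  have hk' : (3 : ℝ) ≤ k := by exact_mod_cast hk
  have hθ : (n : ℝ) ^ (-(1 : ℝ)) ≤ θ k n := by
    rw [θ]
    apply Real.rpow_le_rpow_of_exponent_le hn1
    rw [neg_div, neg_le_neg_iff, div_le_one (by linarith)]
    linarith
  calc ((n : ℝ) - 1) / 2 = (n.choose 2 : ℝ) * (n : ℝ) ^ (-(1 : ℝ)) := by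
        rw [Nat.cast_choose_two, Real.rpow_neg_one]
        field_simp
    _ ≤ T k n := mul_le_mul_of_nonneg_left hθ (Nat.cast_nonneg _)

/-- `T_k(n) → ∞`. [folklore] -/
theorem tendsto_T {k : ℕ} (hk : 3 ≤ k) : Tendsto (fun n => T k n) atTop atTop := by
  have h1 : Tendsto (fun n : ℕ => ((n : ℝ) - 1) / 2) atTop atTop := by
    refine Tendsto.atTop_div_const (by norm_num) ?_
    simpa [sub_eq_add_neg] using tendsto_atTop_add_const_right atTop (-1 : ℝ) tendsto_natCast_atTop_atTop
  refine tendsto_atTop_mono' atTop ?_ h1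
  filter_upwards [eventually_ge_atTop 1] with n hn
  exact T_ge hk hn

/-- `b → 1`. [folklore] -/
theorem tendsto_bfac {k : ℕ} (hk : 3 ≤ k) (w : ℕ) : Tendsto (fun n => bfac k w n) atTop (𝓝 1) := by
  have hT := tendsto_T hk
  have h1 : Tendsto (fun n => (T k n) ^ (-(1 / 4 : ℝ))) atTop (𝓝 0) :=
    (tendsto_rpow_neg_atTop (by norm_num : (0 : ℝ) < 1 / 4)).comp hT
  have h2 : Tendsto (fun n => (w : ℝ) / T k n) atTop (𝓝 0) := tendsto_const_nhds.div_atTop hT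
  have := (tendsto_const_nhds (x := (1 : ℝ))).add h1 |>.add h2
  simpa [bfac] using this

/-- `B → 1/k!`. [folklore] -/
theorem tendsto_Bnd {k : ℕ} (hk : 3 ≤ k) (w : ℕ) :
    Tendsto (fun n => Bnd k w n) atTop (𝓝 (1 / k.factorial)) := by
  have hθ : Tendsto (fun n => θ k n) atTop (𝓝 0) := tendsto_rpow_threshold (k := k) (by omega)
  have hb := tendsto_bfac hk w
  have h := (hθ.mul hb).add ((hb.pow (k.choose 2)).div_const (k.factorial : ℝ))
  simp only [zero_mul, one_pow, zero_add] at h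
  exact h

/-- **The δ-floor.** For `k ≥ 3` and ANY exponent `c`: if `δ > (2w+1)/k!` then `BandLB c k w δ` is false —
the gate-free circuit `x_{e₀}` is `δ`-accurate on every central band eventually. Hence every witness
`(k, w, δ)` of `ConstantBand` has `δ ≤ (2w+1)/k!`. [folklore] -/
theorem not_bandLB_of_delta_gt {c k w : ℕ} {δ : ℝ} (hk : 3 ≤ k)
    (hδ : (2 * w + 1 : ℝ) / k.factorial < δ) : ¬ BandLB c k w δ := by
  intro H
  have hw : (0 : ℝ) < 2 * w + 1 := by positivity
  have hδ' : 1 / (k.factorial : ℝ) < δ / (2 * w + 1) := by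
    rw [lt_div_iff₀ hw]
    have : 1 / (k.factorial : ℝ) * (2 * w + 1) = (2 * w + 1) / k.factorial := by ring
    rw [this]
    exact hδ
  have hev : ∀ᶠ n : ℕ in atTop, Bnd k w n < δ / (2 * w + 1) := (tendsto_order.1 (tendsto_Bnd hk w)).2 _ hδ'
  have hTev : ∀ᶠ n : ℕ in atTop, 1 ≤ T k n := (tendsto_T hk).eventually_ge_atTop 1
  obtain ⟨n, hn, hB, hT1, hn2⟩ := (H.and (hev.and (hTev.and (eventually_ge_atTop 2)))).exists
  have hN : 0 < n.choose 2 := Nat.choose_pos hn2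
  obtain ⟨e₀, -⟩ : (univ : Finset (Edge n)).Nonempty := by
    rw [← card_pos, card_univ, card_edgeSet_top_fin]; exact hN
  have hover : (Circuit.input e₀ : Circuit (Edge n)).IsOver monotoneBasis := by
    intro g hg; simp [Circuit.input] at hg
  have herr : bandErr n k (thr k n) w (Circuit.input e₀) ≤ δ := by
    have hj := central_thr k n
    calc bandErr n k (thr k n) w (Circuit.input e₀)
        ≤ ∑ _i ∈ Icc (thr k n - w) (thr k n + w), δ / (2 * w + 1) := by
          refine sum_le_sum fun i hi => ?_
          have hi' : i ≤ thr k n + w := (mem_Icc.1 hi).2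
          exact (errFrac_input_le_Bnd (by omega) hn2 (by linarith) hj hi' e₀).trans hB.le
      _ = #(Icc (thr k n - w) (thr k n + w)) * (δ / (2 * w + 1)) := by rw [sum_const, nsmul_eq_mul]
      _ ≤ (2 * w + 1) * (δ / (2 * w + 1)) := by
          have hδ0 : 0 < δ := lt_trans (by positivity) hδ
          refine mul_le_mul_of_nonneg_right ?_ (div_nonneg hδ0.le hw.le)
          have : #(Icc (thr k n - w) (thr k n + w)) ≤ 2 * w + 1 := by rw [Nat.card_Icc]; omega
          exact_mod_cast this
      _ = δ := by field_simp
  have hlt := hn (thr k n) (central_thr k n) (Circuit.input e₀) hover herr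
  simp at hlt

/-- **Corollary (necessary smallness of δ).** In every witness of the crux, `δ ≤ (2w+1)/k!`. [folklore] -/
theorem delta_le_of_bandLB {c k w : ℕ} {δ : ℝ} (hk : 3 ≤ k) (H : BandLB c k w δ) :
    δ ≤ (2 * w + 1 : ℝ) / k.factorial := by
  by_contra h
  exact not_bandLB_of_delta_gt hk (not_le.1 h) H

/-! ### §4b The bottom window: `ConstantBandWithoutCentral` fails already at `c = 0` (`j = 0`, circuit `x_{e₀}`) -/

/-- Per-slice bound at the bottom: for `i ≤ w` the error fraction of `x_{e₀}` on slice `i` is at most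
`θ·(w/T) + (w/T)^{C(k,2)}/k!` (`→ 0`). [folklore] -/
theorem errFrac_input_le_bottom {k w n i : ℕ} (hk : 2 ≤ k) (hn : 2 ≤ n) (hT : 0 < T k n) (hi : i ≤ w)
    (e₀ : Edge n) :
    (#(errSet n k i (Circuit.input e₀)) : ℝ) / #(slice n i) ≤
      θ k n * ((w : ℝ) / T k n) + ((w : ℝ) / T k n) ^ k.choose 2 / k.factorial := by
  have hN : 0 < n.choose 2 := Nat.choose_pos hn
  have hθ : 0 < θ k n := θ_pos (by omega)
  have hq0' : (0 : ℝ) ≤ (w : ℝ) / T k n := div_nonneg (Nat.cast_nonneg _) hT.le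
  by_cases hiN : i ≤ n.choose 2
  · have hq : (i : ℝ) / n.choose 2 ≤ θ k n * ((w : ℝ) / T k n) := by
      rw [div_le_iff₀ (by exact_mod_cast hN)]
      have hi' : (i : ℝ) ≤ w := by exact_mod_cast hi
      calc (i : ℝ) ≤ w := hi'
        _ = θ k n * ((w : ℝ) / T k n) * n.choose 2 := by
            rw [T]; field_simp
    have hq0 : (0 : ℝ) ≤ (i : ℝ) / n.choose 2 := by positivity
    calc (#(errSet n k i (Circuit.input e₀)) : ℝ) / #(slice n i)
        ≤ (i : ℝ) / n.choose 2 + (n.choose k : ℝ) * ((i : ℝ) / n.choose 2) ^ k.choose 2 :=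
          errFrac_input_le e₀ hiN hN
      _ ≤ θ k n * ((w : ℝ) / T k n) + (n.choose k : ℝ) * (θ k n * ((w : ℝ) / T k n)) ^ k.choose 2 :=
          add_le_add hq (mul_le_mul_of_nonneg_left (pow_le_pow_left₀ hq0 hq _) (Nat.cast_nonneg _))
      _ = θ k n * ((w : ℝ) / T k n) +
            (n.choose k : ℝ) * (θ k n) ^ k.choose 2 * ((w : ℝ) / T k n) ^ k.choose 2 := by
          rw [mul_pow]; ring
      _ ≤ θ k n * ((w : ℝ) / T k n) + 1 / k.factorial * ((w : ℝ) / T k n) ^ k.choose 2 :=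
          add_le_add le_rfl (mul_le_mul_of_nonneg_right (choose_mul_θ_pow_le (n := n) hk (by omega))
            (pow_nonneg hq0' _))
      _ = _ := by ring
  · have h0 : errSet n k i (Circuit.input e₀) = ∅ := by
      refine filter_eq_empty_iff.2 fun x _ hx => hiN ?_
      rw [← hx.1, edgeCount, ← card_edgeSet_top_fin n, ← card_univ]
      exact card_le_card (filter_subset _ _)
    rw [h0, card_empty, Nat.cast_zero, zero_div]
    positivity

/-- **The bottom window is refuted at `c = 0`.** Without centrality, at `j = 0` the gate-free circuit `x_{e₀}` has
band error `→ 0` (slices `i ≤ w`: an edge is on w.p. `i/C(n,2)`, a `k`-clique w.p. `≤ C(n,k)(w/C(n,2))^{C(k,2)} → 0`),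
so even the exponent-`0` instance of `ConstantBandWithoutCentral` is false: the window is load-bearing at BOTH ends
(top end: `constantBand_false_without_central`). [folklore] -/
theorem not_withoutCentral_zero :
    ¬ ∃ k : ℕ, 3 ≤ k ∧ ∃ w : ℕ, ∃ δ : ℝ, 0 < δ ∧ ∀ᶠ n : ℕ in atTop, ∀ j : ℕ,
      ∀ C : Circuit (Edge n), C.IsOver monotoneBasis → bandErr n k j w C ≤ δ → n ^ 0 < C.size := by
  rintro ⟨k, hk, w, δ, hδ, H⟩
  have hT := tendsto_T hk
  have hθ : Tendsto (fun n => θ k n) atTop (𝓝 0) := tendsto_rpow_threshold (k := k) (by omega)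
  have hwT : Tendsto (fun n => (w : ℝ) / T k n) atTop (𝓝 0) := tendsto_const_nhds.div_atTop hT
  have hB : Tendsto (fun n => θ k n * ((w : ℝ) / T k n) + ((w : ℝ) / T k n) ^ k.choose 2 / k.factorial)
      atTop (𝓝 0) := by
    have h := (hθ.mul hwT).add ((hwT.pow (k.choose 2)).div_const (k.factorial : ℝ))
    have hK : k.choose 2 ≠ 0 := (Nat.choose_pos (by omega : 2 ≤ k)).ne'
    simpa [zero_pow hK] using h
  have hw : (0 : ℝ) < w + 1 := by positivity
  have hev : ∀ᶠ n : ℕ in atTop,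
      θ k n * ((w : ℝ) / T k n) + ((w : ℝ) / T k n) ^ k.choose 2 / k.factorial < δ / (w + 1) :=
    (tendsto_order.1 hB).2 _ (div_pos hδ hw)
  have hTev : ∀ᶠ n : ℕ in atTop, 1 ≤ T k n := hT.eventually_ge_atTop 1
  obtain ⟨n, hn, hBn, hT1, hn2⟩ := (H.and (hev.and (hTev.and (eventually_ge_atTop 2)))).exists
  have hN : 0 < n.choose 2 := Nat.choose_pos hn2
  obtain ⟨e₀, -⟩ : (univ : Finset (Edge n)).Nonempty := by
    rw [← card_pos, card_univ, card_edgeSet_top_fin]; exact hN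
  have hover : (Circuit.input e₀ : Circuit (Edge n)).IsOver monotoneBasis := by
    intro g hg; simp [Circuit.input] at hg
  have herr : bandErr n k 0 w (Circuit.input e₀) ≤ δ := by
    calc bandErr n k 0 w (Circuit.input e₀)
        ≤ ∑ _i ∈ Icc (0 - w) (0 + w), δ / (w + 1) := by
          refine sum_le_sum fun i hi => ?_
          have hi' : i ≤ w := by have := (mem_Icc.1 hi).2; omega
          exact (errFrac_input_le_bottom (by omega) hn2 (by linarith) hi' e₀).trans hBn.le
      _ = #(Icc (0 - w) (0 + w)) * (δ / (w + 1)) := by rw [sum_const, nsmul_eq_mul]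
      _ ≤ (w + 1) * (δ / (w + 1)) := by
          refine mul_le_mul_of_nonneg_right ?_ (div_nonneg hδ.le hw.le)
          have : #(Icc (0 - w) (0 + w)) ≤ w + 1 := by rw [Nat.card_Icc]; omega
          exact_mod_cast this
      _ = δ := by field_simp
  have hlt := hn 0 (Circuit.input e₀) hover herr
  simp at hlt

end DeltaFloor

/-! ## §5 Band pseudo-complements: Berkowitz with slack `w`

On the band `j - w ≤ e(x) ≤ j + w` the negation of a threshold of a RESTRICTED edge count is sandwiched between
two MONOTONE thresholds of the complementary count, with additive slack `2w` in the threshold (at `w = 0` this is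
Berkowitz's exact pseudo-complement `¬x_e = T_{≥ j}(x ∖ e)`):
`T_{≥ j+w+1-t}(x|Sᶜ) ≤ ¬T_{≥ t}(x|S) ≤ T_{≥ j-w+1-t}(x|Sᶜ)`.
So the band measure gives monotone circuits approximate negations of every count whose relevant scale exceeds `w`
(macroscopic densities) for free, and withholds only negations of LOCAL quantities (fluctuation `≤ w`, e.g. single
edges): the obstruction separating `ConstantBand` (w ≥ 1) from `SliceTarget` (w = 0, monotone = general) is exactly
negation at scale `≤ w` — a refinement of the route's remark "no pseudo-complements exist on two adjacent slices"
(true for EXACT pseudo-complements only). -/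

/-- The on-edges split along any edge set `S`. [folklore] -/
theorem card_on_add_card_on_compl {n : ℕ} (x : Edge n → Bool) (S : Finset (Edge n)) :
    #(S.filter fun e => x e = true) + #(Sᶜ.filter fun e => x e = true) = edgeCount x := by
  rw [edgeCount, ← card_union_of_disjoint]
  · congr 1
    ext e
    simp only [mem_union, mem_filter, mem_compl, mem_univ, true_and]
    tauto
  · exact disjoint_filter_filter disjoint_compl_right

/-- **Band pseudo-complement sandwich** (Berkowitz with slack `w`). For `x` in the band `[j-w, j+w]`, any edge set
`S` and threshold `t`: (lower) if `x` has `≥ j+w+1-t` on-edges outside `S` then it has `≤ t-1` on-edges inside `S`;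
(upper) if it has `≤ t-1` on-edges inside `S` then it has `≥ j-w+1-t` on-edges outside `S` (stated additively). [folklore] -/
theorem band_pseudoComplement {n : ℕ} (x : Edge n → Bool) (S : Finset (Edge n)) {j w t : ℕ}
    (hlo : j ≤ edgeCount x + w) (hhi : edgeCount x ≤ j + w) :
    (j + w + 1 ≤ #(Sᶜ.filter fun e => x e = true) + t → #(S.filter fun e => x e = true) + 1 ≤ t) ∧
      (#(S.filter fun e => x e = true) + 1 ≤ t → j + 1 ≤ #(Sᶜ.filter fun e => x e = true) + t + w) := by
  have h := card_on_add_card_on_compl x S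
  constructor <;> intro h' <;> omega

/-- At `w = 0` (one slice) the sandwich closes: the monotone threshold `T_{≥ j+1-t}` of the outside count IS the
negation of `T_{≥ t}` of the inside count — Berkowitz's pseudo-complement (`t = 1`, `S = {e}`: `¬x_e = T_{≥ j}(x ∖ e)`).
[folklore] -/
theorem slice_pseudoComplement {n : ℕ} (x : Edge n → Bool) (S : Finset (Edge n)) {j t : ℕ}
    (hj : edgeCount x = j) :
    j + 1 ≤ #(Sᶜ.filter fun e => x e = true) + t ↔ #(S.filter fun e => x e = true) + 1 ≤ t := by
  have h := card_on_add_card_on_compl x S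
  omega

end Summit.PneNP.PneNP.Cruxes.ConstantBand.Disproof
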